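import Mathlib
import HarnessLib
import Summits.ValiantsHypothesis.ValiantsHypothesis.Theorems.MonotoneRestorationMonotoneRestorationQPLinearWidthParityBase
import Summits.ValiantsHypothesis.ValiantsHypothesis.Theorems.MonotoneRestorationMonotoneRestorationQPLinearWidthExcludedGridPoly

/-!
# Route MonotoneRestoration, crux `MonotoneRestorationQP` (stmt-15886), line `linear_width` —
# THE `√N` RUNG θ_{1/2} FROM THE EXCLUDED GRID THEOREM ALONE

Helper file (`--supports stmt-ValiantsHypothesis-15886`), def-free.  Assembly (A) of the g15 residue list.

Chain: Chuzhoy–Tan's Excluded Grid Theorem as printed, hypothesis (CT) (`ExcludedGridPoly.gridMinorForm_of_chuzhoyTanForm`,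
p842042) ⇒ a `grid (6r) (6r)` minor in every wide pattern ⇒ long wall-edge paths (`WallChains.exists_wallPaths_of_grid_isMinor`,
p842116, through the 5-subdivided wall drawn in the grid, p842082, `IsMinor.trans`, p841952, and `PathSubdivision`, p841989)
⇒ the parity-adaptive base and its chain system (`ParityBase.chainSystem_of_wallPaths`) ⇒ odd covers by the colour fold and
the affine CFI witnesses (`CFIOddCoverChains.widthRung_sqrt_of_chains`, p842034, over `CFIOddCover`, p841932).

* `chainSystem_of_grid_isMinor` — `grid (6r) (6r) ≼ₘ patternGraph E`, `2k+1 ≤ r` ⇒ the (CH₂) data for `E` at width `k`, `C = 14`;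
* `affine12_le_pow4` — `12k + 8 ≤ (k+2)^4`;
* **`widthRung_sqrt_of_chuzhoyTan`** — **(CT) ⇒ `WidthRung (fun n => Nat.sqrt n / 45)`**: assuming only Chuzhoy–Tan 2021
  Thm 1.1 (in print; the tree's standing hypothesis form, as in `TseitinDepthFregeExcludedGrid`), every matrix-symmetric `VP`
  family of degree `≤ √n / 45` that is `PolylogHomDetermined` has square-symmetric circuits of quasi-polynomial ORBIT size.
  This discharges the re-embedding lemma (RE) of census g14 and the inline hypotheses (W1)/(IND₂)/(SUB₂)/(ODD₂)/(CH₂) of the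
  earlier conditional `√N` rungs: θ_{1/2} of the line's ladder now rests on ONE published theorem.

Honest label: θ_{1/2} (degree `√n`) modulo (CT); θ₁ (linear degree, the registered stub `stub_linearDegreeWidthRestoration`),
the cruxes and VP ≠ VNP are NOT moved; no stub closed by name.
[cite: ChuzhoyTan2021, Theorem 1.1; DawarPagoSeppelt2025, Thm 7.3, Thm 7.9; Roberson2022, Thm 3.13; ChenFlumLiu2025, Thm 11.1]
-/

set_option linter.dupNamespace false

noncomputable section

open scoped Classical
open scoped Literature.Combinatorics.SimpleGraph

namespace Summit.ValiantsHypothesis.ValiantsHypothesis.Theorems.CFIOddCover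

open Literature.Combinatorics.SimpleGraph
open Literature.ModelTheory.FiniteModelTheory Literature.ModelTheory.FiniteModelTheory.ChenFlumLiu2025
open Summit.ValiantsHypothesis.ValiantsHypothesis.Theorems.MonotoneRestorationQPLinearWidth

/-- **(CH₂) from a grid minor.**  If `grid (6r) (6r) ≼ₘ patternGraph E` and `2k+1 ≤ r`, the pattern carries a chain system over
a connected base `B` with `tw B ≥ k` and `|CFI(B)| ≤ 14(a+b+1)`. [cite: Diestel2010, §1.7; GalesiEtAl2023, Cor. 9] -/
theorem chainSystem_of_grid_isMinor {a b r k : ℕ} (E : Multiset (Fin a × Fin b)) (hk : 2 * k + 1 ≤ r)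
    (hF : grid (6 * r) (6 * r) ≼ₘ patternGraph E) :
    ∃ (v : ℕ) (B : SimpleGraph (Fin v)), B.Connected ∧ 2 ≤ v ∧
      k ≤ treewidth B ∧ B.edgeSet.Nonempty ∧ Fintype.card (CFIVertex B) ≤ 14 * (a + b + 1) ∧
      ∃ (β : Fin v → Fin a ⊕ Fin b) (n : Dart B → ℕ) (c : Dart B → ℕ → Fin a ⊕ Fin b),
        Function.Injective β ∧ (∀ d, n d.rev = n d) ∧ (∀ d, c d 0 = β d.1.1) ∧
        (∀ d i, i ≤ 2 * n d + 3 → c d.rev i = c d (2 * n d + 3 - i)) ∧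
        (∀ d i, i < 2 * n d + 3 → (patternGraph E).Adj (c d i) (c d (i + 1))) ∧
        (∀ d i, 0 < i → i < 2 * n d + 3 → ∀ u, c d i ≠ β u) ∧
        (∀ d d' i i', 0 < i → i < 2 * n d + 3 → 0 < i' → i' < 2 * n d' + 3 → c d i = c d' i' →
          d' = d ∨ d' = d.rev) := by
  obtain ⟨fv, hfv, ω, hω, hI2, hI3⟩ := exists_wallPaths_of_grid_isMinor hF
  refine chainSystem_of_wallPaths E hk fv hfv
    (fun e i => if h : e ∈ (wall r).edgeSet then (ω e h).getVert i else fv (edgeOut e).1)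
    (fun e => if h : e ∈ (wall r).edgeSet then (ω e h).length else 0)
    (fun e he => ?_) (fun e he => ?_) (fun e he => ?_) (fun e he i hi => ?_) (fun e he i j hi hj hij => ?_)
    (fun e he i hi0 hi z => ?_) (fun e he e' he' i i' hne hi0 hi hi0' hi' => ?_)
  · simp only [dif_pos he]; exact (hω e he).2
  · simp only [dif_pos he, SimpleGraph.Walk.getVert_zero]
  · simp only [dif_pos he, SimpleGraph.Walk.getVert_length]
  · simp only [dif_pos he] at hi ⊢
    exact (ω e he).adj_getVert_succ hi
  · simp only [dif_pos he] at hi hj hij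
    exact (hω e he).1.getVert_injOn (by simpa using hi) (by simpa using hj) hij
  · simp only [dif_pos he] at hi ⊢
    exact hI2 e he i hi0 hi z
  · simp only [dif_pos he, dif_pos he'] at hi hi' ⊢
    exact hI3 e he e' he' i i' hne hi0 hi hi0' hi'

/-- `12k + 8 ≤ (k+2)^4`. [folklore] -/
theorem affine12_le_pow4 (k : ℕ) : 12 * k + 8 ≤ (k + 2) ^ 4 := by
  have h2 : 4 * k + 4 ≤ (k + 2) ^ 2 := by nlinarith
  calc 12 * k + 8 ≤ (4 * k + 4) * (4 * k + 4) := by nlinarith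
    _ ≤ (k + 2) ^ 2 * (k + 2) ^ 2 := Nat.mul_le_mul h2 h2
    _ = (k + 2) ^ 4 := by ring

/-- **THE `√N` RUNG FROM THE EXCLUDED GRID THEOREM ALONE.**  Chuzhoy–Tan's Excluded Grid Theorem as printed (hypothesis (CT):
constants `c₁, c₂ > 0` such that tree-width `≥ c₁ g⁹ log^{c₂} g` forces the `g × g` grid minor) implies
`WidthRung (fun n => Nat.sqrt n / 45)`: every matrix-symmetric `VP` family `f` with `deg f_n ≤ √n/45` that is
`PolylogHomDetermined` satisfies `QPOrbitSymm f`. [cite: ChuzhoyTan2021, Theorem 1.1; DawarPagoSeppelt2025, Thm 7.9; Roberson2022, Thm 3.13] -/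
theorem widthRung_sqrt_of_chuzhoyTan
    (hCT : ∃ c₁ : ℝ, 0 < c₁ ∧ ∃ c₂ : ℝ, 0 < c₂ ∧ ∀ g : ℕ, 2 ≤ g →
      ∀ (V : Type) [Fintype V] (G : SimpleGraph V),
        c₁ * (g : ℝ) ^ 9 * Real.log g ^ c₂ ≤ treewidth G → grid (g - 1) (g - 1) ≼ₘ G) :
    WidthRung fun n => Nat.sqrt n / 45 := by
  obtain ⟨gm, e, hgm, hGM⟩ := gridMinorForm_of_chuzhoyTanForm hCT
  have h := widthRung_sqrt_of_chains 14 (fun k => gm (6 * (2 * k + 1))) (4 * e) (fun k => ?_)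
    (fun k a b E hk hrow hcol htw => chainSystem_of_grid_isMinor E le_rfl (hGM _ (patternGraph E) htw))
  · simpa using h
  · calc gm (6 * (2 * k + 1)) ≤ (6 * (2 * k + 1) + 2) ^ e := hgm _
      _ ≤ ((k + 2) ^ 4) ^ e := Nat.pow_le_pow_left (by have := affine12_le_pow4 k; omega) e
      _ = (k + 2) ^ (4 * e) := by rw [← pow_mul]

end Summit.ValiantsHypothesis.ValiantsHypothesis.Theorems.CFIOddCover

end
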